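import Literature.AlgebraicGeometry.HodgeTheory.FermatAokiStandardCharacterOrbit
import Literature.AlgebraicGeometry.HodgeTheory.FermatAokiCycleInvariance
import Literature.AlgebraicGeometry.HodgeTheory.FermatRationalSupport
import Literature.AlgebraicGeometry.HodgeTheory.CycleClassPrincipalDivisorOfProjectiveSpace
import HarnessLib

/-!
# Aoki's Thm. 2-1: "`Y` represents `σ_{p,1}`" implies "`Y` represents `σ_{p,a}`" for every `a` prime to `d`

Family `hodge`, layer `Literature/AlgebraicGeometry/HodgeTheory`. PROOF FILE (theorems only, no named
fact; sequel of `FermatAokiCycleInvariance` and `FermatAokiStandardCharacterOrbit`) for the leaf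
`Aoki1987_thm_2_1_supportedClass` of `Aoki1987_claim_pStandard` — N. Aoki, J. Math. Soc. Japan 39
(1987), Thm. 2-1 (p. 388): "`Y` … represents the class `σ_{p,a}`", `Y` being the variety (2.1), which
does not depend on `a`. The symmetric group of `x₀, …, x_{p-1}` stabilises `Y`, the cycle class of `Y`
is rational, and `σ_{p,a} = (t·σ_{p,1}) ∘ π` (`t ∈ (ℤ/m)ˣ`, `π ∈ 𝔖_p`); so `ω_{σ_{p,a}}([Y]) ≠ 0` for
ONE `a` prime to `d` gives it for ALL such `a` — the leaf reduces to Thm. 2-1 for `a = 1`.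

* `permProjMap_preimage_zeroLocus` — `[z] ↦ [z ∘ π]` pulls `V₊(S)` back to `V₊(σ_π S)`;
* `Aoki1987.image_aokiEquations_permSubst`, `Aoki1987.preimage_fermatAokiSection_permAut` — **the
  equations (2.1), hence `Y ∩ X²ʳₘ`, are preserved by every permutation of the coordinates fixing
  `x_p`** (`e_k` depends only on the multiset of its arguments; `𝔖_p ⊆ Stab(Y)`);
* `Aoki1987.map_permAut_cycleClass_fermatAokiCycle_eq` — `p_π^* cl[Y] = cl[Y]` for such `π`
  (`Aoki1987.map_cycleClass_fermatAokiCycle_eq`);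
* `fermatProjector_map_permMap` — **`π_α(p_π^* c) = p_π^*(π_{α∘π} c)`** (`p_π^* V(β) ⊆ V(β ∘ π⁻¹)`,
  `map_permMap_mem_fermatEigenspace`), and `fermatProjector_comp_eq_zero_iff_of_map_eq`;
* **`Aoki1987.fermatProjector_aokiStandard_cycleClass_eq_zero_iff`** —
  `ω_{σ_{p,a}}([Y]) = 0 ↔ ω_{σ_{p,1}}([Y]) = 0` for `(⟨a⟩, d) = 1` (with the `(ℤ/m)ˣ`-stability of
  the eigen-support of the RATIONAL class `cl[Y]`, `fermatProjector_eq_zero_iff_unitMul`,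
  `isRationalClass_cycleClass`);
* **`Aoki1987_thm_2_1_supportedClass_of_projector_cycleClass_one_ne_zero`** — the leaf from
  "`ω_{σ_{p,1}}([Y_{c₀} ∩ X²ʳₘ]) ≠ 0` for some `c₀`", i.e. from Thm. 2-1 for `a = 1` alone.

What is NOT here: `ω_{σ_{p,1}}([Y]) ≠ 0` (Aoki §4: `ω_σ(Y)·\overline{ω_σ(Y)} = (-1)ʳ p^{p-2} mᵖ` through
the intersection numbers `I(Y, Yᵍ)` — needs the compatibility of cup product of cycle classes with
intersection numbers, not in the tree).

## References

* [Aoki1987] N. Aoki, Some new algebraic cycles on Fermat varieties, J. Math. Soc. Japan 39 (1987)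
  385–396: p. 386 ("represents"), §1 (p. 387), (2.1) and Thm. 2-1 (p. 388), §4.
* [Shioda1979HodgeFermat] T. Shioda, The Hodge conjecture for Fermat varieties, Math. Ann. 245 (1979)
  175–184, §1 (the symmetries of `Xⁿₘ`) (cite-only).
* [Shioda1979PJA] T. Shioda, Proc. Japan Acad. 55A (1979) 111–114, §1 eq. (2) ("for all
  `t ∈ (ℤ/m)ˣ`").
* [Hartshorne1977] R. Hartshorne, Algebraic Geometry (1977), II Example 7.1.1.
-/

noncomputable section

open CategoryTheory AlgebraicGeometry MvPolynomial Finset Order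

namespace Literature.AlgebraicGeometry.HodgeTheory

open Literature.AlgebraicGeometry.Motives Literature.AlgebraicTopology.SingularHomology

/-! ## Permutations of the coordinates fixing `x_p` preserve `Y` -/

section Perm

variable {n : ℕ}

/-- `[z] ↦ [z ∘ π]` pulls `V₊(S) ⊆ ℙⁿ⁺¹` back to `V₊(σ_π S)` (`σ_π : xᵢ ↦ x_{π i}`; on points Mathlib's
`Proj.map` is `𝔭 ↦ σ_π⁻¹ 𝔭`), as for the diagonal substitutions
(`diagonalProjMap_preimage_zeroLocus`). [cite: Hartshorne1977, II Example 7.1.1] -/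
theorem permProjMap_preimage_zeroLocus (π : Equiv.Perm (Fin (n + 2)))
    (S : Set (MvPolynomial (Fin (n + 2)) ℂ)) :
    letI := MvPolynomial.gradedAlgebra (σ := Fin (n + 2)) (R := ℂ)
    (permProjMap π).left.base ⁻¹'
        ProjectiveSpectrum.zeroLocus (MvPolynomial.homogeneousSubmodule (Fin (n + 2)) ℂ) S =
      ProjectiveSpectrum.zeroLocus (MvPolynomial.homogeneousSubmodule (Fin (n + 2)) ℂ)
        (aeval (permSubst π) '' S) := by
  letI := MvPolynomial.gradedAlgebra (σ := Fin (n + 2)) (R := ℂ)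
  ext p
  change S ⊆ aeval (permSubst π) ⁻¹'
      ((p : ProjectiveSpectrum (MvPolynomial.homogeneousSubmodule (Fin (n + 2)) ℂ)).asHomogeneousIdeal :
        Set _) ↔
    aeval (permSubst π) '' S ⊆
      ((p : ProjectiveSpectrum (MvPolynomial.homogeneousSubmodule (Fin (n + 2)) ℂ)).asHomogeneousIdeal :
        Set _)
  exact Set.image_subset_iff.symm

end Perm

namespace Aoki1987

variable {m r d : ℕ}

/-- For a permutation `π` of `Fin (p + 1)` fixing the last index, `i ↦ π (castSucc i)` and `castSucc`
have the same image (the indices `≠ last`). [folklore] -/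
theorem image_perm_castSucc_eq {p : ℕ} {π : Equiv.Perm (Fin (p + 1))} (hπ : π (Fin.last p) = Fin.last p) :
    (univ : Finset (Fin p)).image (fun i ↦ π (Fin.castSucc i)) = (univ : Finset (Fin p)).image Fin.castSucc := by
  classical
  have hsub : ∀ (σ : Equiv.Perm (Fin (p + 1))), σ (Fin.last p) = Fin.last p →
      (univ : Finset (Fin p)).image (fun i ↦ σ (Fin.castSucc i)) ⊆ univ.erase (Fin.last p) := by
    intro σ hσ x hx
    obtain ⟨i, -, rfl⟩ := Finset.mem_image.mp hx
    refine Finset.mem_erase.mpr ⟨fun h ↦ ?_, Finset.mem_univ _⟩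
    have h' : Fin.castSucc i = Fin.last p := σ.injective (h.trans hσ.symm)
    exact (Fin.castSucc_lt_last i).ne h'
  have hcard : ∀ (σ : Equiv.Perm (Fin (p + 1))),
      ((univ : Finset (Fin p)).image (fun i ↦ σ (Fin.castSucc i))).card = p := fun σ ↦ by
    rw [Finset.card_image_of_injective univ (f := fun i ↦ σ (Fin.castSucc i))
      (fun a b hab ↦ Fin.castSucc_injective _ (σ.injective hab)), card_univ, Fintype.card_fin]
  have hle : ∀ (σ : Equiv.Perm (Fin (p + 1))),
      (univ.erase (Fin.last p)).card ≤ ((univ : Finset (Fin p)).image (fun i ↦ σ (Fin.castSucc i))).card := by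
    intro σ
    rw [hcard, Finset.card_erase_of_mem (mem_univ _), card_univ, Fintype.card_fin]
    omega
  have h1 := Finset.eq_of_subset_of_card_le (hsub π hπ) (hle π)
  have h2 := Finset.eq_of_subset_of_card_le (hsub 1 rfl) (hle 1)
  rw [h1]
  exact h2.symm

/-- `σ_π f₀ = f₀` for `π` fixing `x_p`: `x_{π p}ᵖ - c ∏ᵢ x_{π i} = x_pᵖ - c ∏ᵢ xᵢ`.
[cite: Aoki1987, (2.1) (p. 388)] -/
theorem aeval_permSubst_f0 {π : Equiv.Perm (Fin (2 * r + 2))} (hπ : π (Fin.last (2 * r + 1)) = Fin.last (2 * r + 1))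
    (c : ℂ) :
    aeval (permSubst π) (X (Fin.last (2 * r + 1)) ^ (2 * r + 1) -
        C c * ∏ i : Fin (2 * r + 1), X (Fin.castSucc i) : MvPolynomial (Fin (2 * r + 2)) ℂ) =
      X (Fin.last (2 * r + 1)) ^ (2 * r + 1) - C c * ∏ i : Fin (2 * r + 1), X (Fin.castSucc i) := by
  classical
  simp only [map_sub, map_pow, map_mul, aeval_X, permSubst_apply, aeval_C, MvPolynomial.algebraMap_eq,
    map_prod, hπ]
  congr 2
  rw [← Finset.prod_image (s := univ) (g := fun i ↦ π (Fin.castSucc i)) (f := fun k ↦ (X k : MvPolynomial (Fin (2 * r + 2)) ℂ))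
      fun a _ b _ hab ↦ Fin.castSucc_injective _ (π.injective hab),
    image_perm_castSucc_eq hπ,
    Finset.prod_image fun a _ b _ hab ↦ Fin.castSucc_injective _ hab]

/-- `σ_π e_k(x₀ᵈ, …, x_{p-1}ᵈ) = e_k(x₀ᵈ, …, x_{p-1}ᵈ)` for `π` fixing `x_p` (`e_k` depends only on
the multiset of its arguments). [cite: Aoki1987, (2.1) (p. 388)] -/
theorem aeval_permSubst_esymm {π : Equiv.Perm (Fin (2 * r + 2))}
    (hπ : π (Fin.last (2 * r + 1)) = Fin.last (2 * r + 1)) (d j : ℕ) :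
    aeval (permSubst π) (aeval (fun i : Fin (2 * r + 1) ↦
        (X (Fin.castSucc i) : MvPolynomial (Fin (2 * r + 2)) ℂ) ^ d) (esymm (Fin (2 * r + 1)) ℂ j)) =
      aeval (fun i : Fin (2 * r + 1) ↦ (X (Fin.castSucc i) : MvPolynomial (Fin (2 * r + 2)) ℂ) ^ d)
        (esymm (Fin (2 * r + 1)) ℂ j) := by
  classical
  rw [MvPolynomial.comp_aeval_apply, MvPolynomial.aeval_esymm_eq_multiset_esymm,
    MvPolynomial.aeval_esymm_eq_multiset_esymm]
  simp only [map_pow, aeval_X, permSubst_apply]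
  congr 1
  have h1 : (univ : Finset (Fin (2 * r + 1))).val.map (fun i ↦ (X (π (Fin.castSucc i)) : MvPolynomial (Fin (2 * r + 2)) ℂ) ^ d) =
      ((univ : Finset (Fin (2 * r + 1))).image (fun i ↦ π (Fin.castSucc i))).val.map
        (fun k ↦ (X k : MvPolynomial (Fin (2 * r + 2)) ℂ) ^ d) := by
    rw [Finset.image_val_of_injOn fun a _ b _ hab ↦ Fin.castSucc_injective _ (π.injective hab),
      Multiset.map_map]
    rfl
  have h2 : (univ : Finset (Fin (2 * r + 1))).val.map (fun i ↦ (X (Fin.castSucc i) : MvPolynomial (Fin (2 * r + 2)) ℂ) ^ d) =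
      ((univ : Finset (Fin (2 * r + 1))).image Fin.castSucc).val.map
        (fun k ↦ (X k : MvPolynomial (Fin (2 * r + 2)) ℂ) ^ d) := by
    rw [Finset.image_val_of_injOn fun a _ b _ hab ↦ Fin.castSucc_injective _ hab, Multiset.map_map]
    rfl
  rw [h1, h2, image_perm_castSucc_eq hπ]

/-- **The equations (2.1) are fixed by `σ_π` for every permutation `π` of the coordinates fixing `x_p`.**
[cite: Aoki1987, (2.1) (p. 388)] -/
theorem image_aokiEquations_permSubst {π : Equiv.Perm (Fin (2 * r + 2))}
    (hπ : π (Fin.last (2 * r + 1)) = Fin.last (2 * r + 1)) (c : ℂ) :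
    aeval (permSubst π) '' aokiEquations r d c = aokiEquations r d c := by
  have hfix : Set.EqOn (aeval (permSubst π)) id (aokiEquations r d c) := by
    intro g hg
    rcases Set.mem_insert_iff.mp hg with rfl | hg'
    · exact aeval_permSubst_f0 hπ c
    · obtain ⟨j, -, rfl⟩ := hg'
      exact aeval_permSubst_esymm hπ d j
  rw [hfix.image_eq, Set.image_id]

/-- **`[z] ↦ [z ∘ π]` maps `Y ⊆ ℙᵖ` onto itself** for `π` fixing `x_p`.
[cite: Aoki1987, Thm. 2-1 (p. 388)] -/
theorem preimage_aokiSubvariety_permProjMap {π : Equiv.Perm (Fin (2 * r + 2))}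
    (hπ : π (Fin.last (2 * r + 1)) = Fin.last (2 * r + 1)) (c : ℂ) :
    (permProjMap π).left.base ⁻¹' aokiSubvariety r d c = aokiSubvariety r d c := by
  letI := MvPolynomial.gradedAlgebra (σ := Fin (2 * r + 2)) (R := ℂ)
  change (permProjMap π).left.base ⁻¹'
      ProjectiveSpectrum.zeroLocus (MvPolynomial.homogeneousSubmodule (Fin (2 * r + 2)) ℂ)
        (aokiEquations r d c) =
    ProjectiveSpectrum.zeroLocus (MvPolynomial.homogeneousSubmodule (Fin (2 * r + 2)) ℂ)
      (aokiEquations r d c)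
  rw [permProjMap_preimage_zeroLocus, image_aokiEquations_permSubst hπ]

/-- **The automorphism `p_π` of `X²ʳₘ` preserves `Y ∩ X²ʳₘ`** for `π` fixing `x_p` (`𝔖_p ⊆ Stab(Y)`:
the equations of `Y` are symmetric in `x₀, …, x_{p-1}`). [cite: Aoki1987, Thm. 2-1 (p. 388)] -/
theorem preimage_fermatAokiSection_permAut {π : Equiv.Perm (Fin (2 * r + 2))}
    (hπ : π (Fin.last (2 * r + 1)) = Fin.last (2 * r + 1)) (c : ℂ) :
    (permAut (fermatPolynomial ℂ (2 * r) m) (mem_permStabilizer_fermatPolynomial m π)).left.base ⁻¹'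
        fermatAokiSection m r d c = fermatAokiSection m r d c := by
  have hcomp : ∀ z : ↥(fermatHypersurface (2 * r) m).left,
      (SmoothHypersurface.hypersurfaceι (fermatPolynomial ℂ (2 * r) m)).left.base
          ((permAut (fermatPolynomial ℂ (2 * r) m) (mem_permStabilizer_fermatPolynomial m π)).left.base z) =
        (permProjMap π).left.base
          ((SmoothHypersurface.hypersurfaceι (fermatPolynomial ℂ (2 * r) m)).left.base z) := by
    intro z
    have h := congrArg (fun f ↦ f.base z)
      (permAut_left_comp_ι (fermatPolynomial ℂ (2 * r) m) (mem_permStabilizer_fermatPolynomial m π))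
    simpa using h
  ext z
  simp only [fermatAokiSection, Set.mem_preimage, hcomp]
  rw [← Set.mem_preimage, preimage_aokiSubvariety_permProjMap hπ c]

/-- **`p_π^* cl[Y] = cl[Y]` for every permutation `π` of the coordinates fixing `x_p`** (the
complex-orientation cycle class; `map_cycleClass_fermatAokiCycle_eq` with `p_{π⁻¹}`).
[cite: Aoki1987, Thm. 2-1 (p. 388) and §4 (4.1)] -/
theorem map_permAut_cycleClass_fermatAokiCycle_eq (hr : 0 < r) (hm : 1 ≤ m) (hd : 0 < d) (c : ℂ)
    (hX : IsSmoothProjective (2 * r) (fermatHypersurface (2 * r) m)) (hrr : r + r = 2 * r)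
    (ρ : ResolutionFamily (fermatHypersurface (2 * r) m) r)
    {π : Equiv.Perm (Fin (2 * r + 2))} (hπ : π (Fin.last (2 * r + 1)) = Fin.last (2 * r + 1)) :
    complexBetti.map (permAut (fermatPolynomial ℂ (2 * r) m) (mem_permStabilizer_fermatPolynomial m π)) (2 * r)
        (cycleClass complexOrientationFamily hX hrr ρ (fermatAokiCycle hr hm hd c)) =
      cycleClass complexOrientationFamily hX hrr ρ (fermatAokiCycle hr hm hd c) := by
  have hπ' : π⁻¹ (Fin.last (2 * r + 1)) = Fin.last (2 * r + 1) := by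
    rw [Equiv.Perm.inv_eq_iff_eq]; exact hπ.symm
  have hinv : π⁻¹ ∈ permStabilizer (fermatPolynomial ℂ (2 * r) m) := mem_permStabilizer_fermatPolynomial m π⁻¹
  refine map_cycleClass_fermatAokiCycle_eq hr hm hd c hX hrr ρ
    (s := permAut (fermatPolynomial ℂ (2 * r) m) hinv) ?_ (preimage_fermatAokiSection_permAut hπ' c)
  exact Over.OverMorphism.ext (by
    rw [Over.comp_left]
    exact permAut_left_inv_comp (fermatPolynomial ℂ (2 * r) m) (mem_permStabilizer_fermatPolynomial m π))

end Aoki1987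

/-! ## The isotypic projectors under permutations; Thm. 2-1 for one `a` gives it for all `a` -/

section Projector

variable {n m : ℕ}

/-- **`π_α(p_π^* c) = p_π^*(π_{α∘π} c)`**: `p_π^*` carries `V(β)` into `V(β ∘ π⁻¹)`
(`map_permMap_mem_fermatEigenspace`), so in `c = Σ_β π_β c` only `β = α ∘ π` contributes to the
`α`-component of `p_π^* c`. [cite: Shioda1979HodgeFermat, §1] [cite: Aoki1987, §1] -/
theorem fermatProjector_map_permMap [NeZero m] (α : Fin (n + 2) → ZMod m) (π : Equiv.Perm (Fin (n + 2))) {k : ℕ}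
    (c : complexBetti (fermatHypersurface n m) k) :
    fermatProjector m α k (singularCohomology.map ℂ ℂ
        (permMap (fermatPolynomial ℂ n m) (mem_permStabilizer_fermatPolynomial m π)) k c) =
      singularCohomology.map ℂ ℂ (permMap (fermatPolynomial ℂ n m) (mem_permStabilizer_fermatPolynomial m π)) k
        (fermatProjector m (α ∘ π) k c) := by
  classical
  set P := singularCohomology.map ℂ ℂ
    (permMap (fermatPolynomial ℂ n m) (mem_permStabilizer_fermatPolynomial m π)) k with hP
  conv_lhs => rw [← sum_fermatProjector c]
  rw [map_sum, map_sum]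
  rw [Finset.sum_eq_single (α ∘ π)]
  · exact fermatProjector_apply_of_mem (by
      have h := map_permMap_mem_fermatEigenspace π (fermatProjector_mem (α ∘ π) c)
      have h2 : (α ∘ π) ∘ π.symm = α := by funext j; simp
      rwa [h2] at h)
  · intro β _ hβ
    refine fermatProjector_apply_of_mem_of_ne (map_permMap_mem_fermatEigenspace π (fermatProjector_mem β c)) ?_
    intro h
    apply hβ
    rw [← h]
    funext j; simp
  · intro h; exact absurd (Finset.mem_univ _) h

/-- **`π_{α∘π}(p... ` zero-iff form**: for a class `c` fixed by `p_π^*`, `π_{α∘π} c = 0 ↔ π_α c = 0`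
(`p_π^*` is injective). [cite: Aoki1987, §1] -/
theorem fermatProjector_comp_eq_zero_iff_of_map_eq [NeZero m] (α : Fin (n + 2) → ZMod m)
    (π : Equiv.Perm (Fin (n + 2))) {k : ℕ} {c : complexBetti (fermatHypersurface n m) k}
    (hc : singularCohomology.map ℂ ℂ
        (permMap (fermatPolynomial ℂ n m) (mem_permStabilizer_fermatPolynomial m π)) k c = c) :
    fermatProjector m (α ∘ π) k c = 0 ↔ fermatProjector m α k c = 0 := by
  have key := fermatProjector_map_permMap α π c
  rw [hc] at key
  constructor
  · intro h
    rw [key, h, map_zero]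
  · intro h
    rw [h] at key
    have h2 := congrArg (singularCohomology.map ℂ ℂ
      (permMap (fermatPolynomial ℂ n m) (inv_mem (mem_permStabilizer_fermatPolynomial m π))) k) key
    rw [map_zero, map_permMap_inv_map_permMap] at h2
    exact h2.symm

end Projector

namespace Aoki1987

variable {m r d : ℕ}

/-- **`ω_{σ_{p,a}}([Y]) = 0 ↔ ω_{σ_{p,1}}([Y]) = 0` for every `a` prime to `d`**: Thm. 2-1 for
`σ_{p,1}` is Thm. 2-1 for all `σ_{p,a}`. Indeed `σ_{p,a} = (t·σ_{p,1}) ∘ π` for a unit `t` and a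
permutation `π` fixing `x_p` (`FermatCharacter.exists_aokiStandard_eq_unit_mul_one_comp`);
`cl[Y]` is fixed by `p_π^*` (`map_permAut_cycleClass_fermatAokiCycle_eq`), so
`ω_{(tσ)∘π} = 0 ↔ ω_{tσ} = 0` (`fermatProjector_comp_eq_zero_iff_of_map_eq`), and `cl[Y]` is a rational
class (`isRationalClass_cycleClass`), whose eigen-support is `(ℤ/m)ˣ`-stable
(`fermatProjector_eq_zero_iff_unitMul`). [cite: Aoki1987, §1 (p. 387) and Thm. 2-1 (p. 388)]
[cite: Shioda1979PJA, §1 eq. (2)] -/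
theorem fermatProjector_aokiStandard_cycleClass_eq_zero_iff [NeZero m] (hr : 0 < r) (hm : 1 ≤ m)
    (hd : 0 < d) (c : ℂ) (hX : IsSmoothProjective (2 * r) (fermatHypersurface (2 * r) m))
    (hrr : r + r = 2 * r) (ρ : ResolutionFamily (fermatHypersurface (2 * r) m) r)
    (hp : (2 * r + 1).Prime) (hpm : 2 * r + 1 ∣ m) {a : ZMod m} (ha : Nat.Coprime a.val (m / (2 * r + 1))) :
    fermatProjector m (FermatCharacter.aokiStandard r m a) (2 * r)
        (cycleClass complexOrientationFamily hX hrr ρ (fermatAokiCycle hr hm hd c)) = 0 ↔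
      fermatProjector m (FermatCharacter.aokiStandard r m 1) (2 * r)
        (cycleClass complexOrientationFamily hX hrr ρ (fermatAokiCycle hr hm hd c)) = 0 := by
  obtain ⟨t, π, hπ, hσ⟩ := FermatCharacter.exists_aokiStandard_eq_unit_mul_one_comp hp hpm ha
  rw [hσ, fermatProjector_comp_eq_zero_iff_of_map_eq _ π
    (map_permAut_cycleClass_fermatAokiCycle_eq hr hm hd c hX hrr ρ hπ)]
  exact (fermatProjector_eq_zero_iff_unitMul (isRationalClass_cycleClass hX hrr ρ _)
    (FermatCharacter.aokiStandard r m 1) t).symm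

end Aoki1987

/-! ## The leaf from Thm. 2-1 for `σ_{p,1}` alone -/

/-- **`Aoki1987_thm_2_1_supportedClass` from "`Y` represents `σ_{p,1}`".** Granted, for `p = 2r + 1`
prime, `p ∣ m`, `d = m/p > 2` (and the bookkeeping `hX`, `hrr`, `ρ`), a constant `c₀` for which the
`σ_{p,1}`-component of the cycle class of `[Y_{c₀} ∩ X²ʳₘ]` is non-zero (Thm. 2-1 for `a = 1`:
`ω_σ(Y)·\overline{ω_σ(Y)} = (-1)ʳ p^{p-2} mᵖ ≠ 0`), the leaf holds for EVERY `a` prime to `d`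
(`Aoki1987.fermatProjector_aokiStandard_cycleClass_eq_zero_iff` and
`Aoki1987_thm_2_1_supportedClass_of_projector_cycleClass_ne_zero`).
[cite: Aoki1987, Thm. 2-1 (p. 388), §1 (p. 387) and p. 386 ("represents")] -/
theorem Aoki1987_thm_2_1_supportedClass_of_projector_cycleClass_one_ne_zero
    (h : ∀ (m r : ℕ) [NeZero m] (hr : 0 < r) (hm : 1 ≤ m) (hd : 0 < m / (2 * r + 1))
      (hX : IsSmoothProjective (2 * r) (fermatHypersurface (2 * r) m)) (hrr : r + r = 2 * r)
      (ρ : ResolutionFamily (fermatHypersurface (2 * r) m) r),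
      (2 * r + 1).Prime → 2 * r + 1 ∣ m → 2 < m / (2 * r + 1) →
      ∃ c₀ : ℂ, fermatProjector m (FermatCharacter.aokiStandard r m 1) (2 * r)
        (cycleClass complexOrientationFamily hX hrr ρ
          (Aoki1987.fermatAokiCycle hr hm hd c₀)) ≠ 0) :
    Aoki1987_thm_2_1_supportedClass := by
  refine Aoki1987_thm_2_1_supportedClass_of_projector_cycleClass_ne_zero
    fun m r _ hr hm hd hX hrr ρ hp hpm hd2 a ha ↦ ?_
  obtain ⟨c₀, hc₀⟩ := h m r hr hm hd hX hrr ρ hp hpm hd2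
  exact ⟨c₀, fun h0 ↦ hc₀ ((Aoki1987.fermatProjector_aokiStandard_cycleClass_eq_zero_iff hr hm hd c₀ hX hrr ρ
    hp hpm ha).mp h0)⟩

end Literature.AlgebraicGeometry.HodgeTheory

end
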